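import Mathlib
import HarnessLib
import Literature.MathematicalPhysics.StatisticalMechanics.RenormalisationMapLipschitzABKMQ
import Literature.MathematicalPhysics.StatisticalMechanics.RenormalisationMapZero
import Literature.MathematicalPhysics.StatisticalMechanics.RenormalisationMapSplit

/-!
# The reblocked double sum of `S_k` for TWO STEP KERNELS: the summed comparison bound
# ([ABKM19] Lemma 9.6 at first order ⊗ Lemma 8.4 (ℓ = 1); hypothesis (12.53) of Lemma 12.6, raw form)

`RenormalisationMapLipschitzABKMQ.tayNormLE_sum_reblockTerm_sub_abkm_of_stepKernelBounds` bounds the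
difference of the reblocked double sums
`Σ_{π(X)=U} Σ_{X₁} (e^{−H̃})^{U∖X}(e^{H̃})^{X∖U}(1−e^{−H̃})^{X₁} R^{(q)} P₂(e^{−H},K)(X∖X₁)`
(`= K_{k+1}(U)` by `nextKStep_eq_sum`) at two data `(H̃,H,K)`, `(H̃',H',K')` for ONE step kernel.
This file is the two-KERNEL twin needed for the `q`-dependence of `S_k` ([ABKM19] Lemma 12.6,
(12.53)): the SAME `(H, K)`, two free extracted Hamiltonians `H̃, H̃'` (in the application
`H̃ = A^{(q)}_kH + B^{(q)}_kK`, `H̃' = A^{(q')}_kH + B^{(q')}_kK`), and two step kernels `𝒞a, 𝒞b`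
(`StepKernelBounds` relative to the `q = 0` weights) entering through `R_a = fluct 𝒞a` and
`R_b = fluct 𝒞b`.  The kernel comparison is taken as an abstract PAIR PROPERTY `hdiff`
(`‖R_aF − R_bF‖_{k:k+1,X} ≤ b·ℓ·κ^{|X|_k}` for `‖F‖_{k,X} ≤ b` on every `k`-polymer `X`), supplied for
the torus kernels by `FluctuationKernelComparisonProperty.tayNormLE_fluct_sub_fluct_pow_abkm`
(Lemma 8.4, `ℓ = 1`).

* **`tayNormLE_sum_reblockTerm_kernel_sub_abkm`** — in `|·|_{T_{k+1}^{U*}, w_{k+1}^U}` the difference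
  is bounded by the four summands of `tayNormLE_sum_reblockTerm_sub` with `a₁ = a₂ = e^{1/4}`,
  `a₃ = 8e^{1/4}τ`, `δᵢ = 16e^{3/8}‖H̃ − H̃'‖_{k,0}`, `g = b_{P₂}A_{𝒫,a}^{|X∖X₁|_k}` and
  `ρ = [X∖X₁ ≠ ∅]·b_{P₂}·ℓ·κ^{|X∖X₁|_k}` (for `X₁ = X` the inner factor is `R_a1 − R_b1 = 0`).

No smallness is extracted here (the constant may be as large as it likes: Lemma 12.6 is used through
Brouwer's theorem, `RGFlowStableManifoldBrouwer`).  Everything is proved; no named fact.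

## References
* S. Adams, S. Buchholz, R. Kotecký, S. Müller, arXiv:1910.13564, Lemma 9.6, Lemma 8.4, Lemma 12.6
  (12.53), Definition 6.5 (6.34) [AdamsBuchholzKoteckyMuller2019].
-/

noncomputable section

namespace Literature.MathematicalPhysics.StatisticalMechanics.GradientRG

open scoped BigOperators Classical
open Finset Matrix
open Literature.MathematicalPhysics.StatisticalMechanics.TorusPolymer
  (IsPolymer blocks polys bprod blockOf thicken reblock mem_polys mem_blocks numBlocks isPolymer_blockOf
    thicken_mono thicken_mono_rad thicken_thicken subset_thicken)
open Literature.Barriers.CriticalPhenomena.LongRangePhi4.Polymer (IsConn components)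
open Literature.MathematicalPhysics.QuantumFieldTheory

variable {d M : ℕ} [NeZero M]

set_option maxHeartbeats 1600000 in
/-- **The summed two-kernel comparison bound of the reblocked terms, torus data** (module docstring):
`d ≥ 3`, `L` odd, `L ≥ 2^{d+3}+16R`, `R ≥ 2`, `M = L^N`, `k + 1 ≤ N`; two step kernels `𝒞a, 𝒞b` with
`StepKernelBounds` relative to the `q = 0` weights and the pair property `hdiff` (constants `ℓ, κ ≥ 0`);
`U` a `(k+1)`-polymer; `H̃, H̃'` with `‖·‖_{k,0} ≤ τ ≤ 1/16`; `H` with `‖H‖_{k,0} ≤ 1/16`; `K` factorising,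
`K(∅) = 1`, `C^{r₀}`, local, `‖K‖_k ≤ C`.  Then the difference of the double sums at `(H̃, R_a)` and
`(H̃', R_b)` is bounded in `|·|_{T_{k+1}^{U*}, w_{k+1}^U}` by the displayed four-summand expression.
[cite: AdamsBuchholzKoteckyMuller2019, Lemma 9.6 (proof, first order) / Lemma 12.6 (12.53)] -/
theorem tayNormLE_sum_reblockTerm_kernel_sub_abkm {L N Mord R n p r₀ : ℕ} {θbar lam μ δ₁ δ₀ A𝒫 A𝒫a A𝒫b C₂a C₂b h A : ℝ}
    {𝒞 : ℕ → (Fin d → ZMod M) → ℝ} (hd : 3 ≤ d) (hLodd : Odd L) (hL : 2 ^ (d + 3) + 16 * R ≤ L)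
    (hR2 : 2 ≤ R) (hM : M = L ^ N) {k : ℕ} (hkN : k + 1 ≤ N)
    {𝒞a 𝒞b : (Fin d → ZMod M) → ℝ}
    (hSa : StepKernelBounds (abkmWeightData L N Mord R θbar (schedDelta δ₀ δ₁ N) 𝒞) L k A𝒫a C₂a 𝒞a)
    (hSb : StepKernelBounds (abkmWeightData L N Mord R θbar (schedDelta δ₀ δ₁ N) 𝒞) L k A𝒫b C₂b 𝒞b)
    (hp : d / 2 + 1 ≤ p) (hMord : d / 2 + 1 ≤ Mord)
   
    (hB : AbkmWeightBounds L N Mord R n θbar lam μ δ₁ δ₀ A𝒫 𝒞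
      (abkmWeightData L N Mord R θbar (schedDelta δ₀ δ₁ N) 𝒞))
    (hδ₀ : 0 < δ₀) (hδ₁ : 0 < δ₁) (hh : 0 < h) (hh0 : hZeroSq d R δ₀ δ₁ ≤ h ^ 2) (hA𝒫 : 0 ≤ A𝒫a) (hA : 0 < A)
    {U : Finset (Fin d → ZMod M)} (hU : IsPolymer (L ^ (k + 1)) U)
    {Ht Ht' H : RelevantHamiltonian ℂ d} {τ : ℝ}
    (hHt : hamNorm (fieldWt h (L : ℝ) d k) ((L : ℝ) ^ k) (L ^ (d * k)) Ht ≤ τ)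
    (hHt' : hamNorm (fieldWt h (L : ℝ) d k) ((L : ℝ) ^ k) (L ^ (d * k)) Ht' ≤ τ) (hτ : τ ≤ 1 / 16)
    (hH : hamNorm (fieldWt h (L : ℝ) d k) ((L : ℝ) ^ k) (L ^ (d * k)) H ≤ 1 / 16)
    {K : Finset (Fin d → ZMod M) → ((Fin d → ZMod M) → ℝ) → ℂ} {C : ℝ} (hC : 0 ≤ C)
    (hK : WeakNormLE (abkmNormParams L N Mord R p r₀ h θbar A (schedDelta δ₀ δ₁ N) 𝒞) k K C)
    (hKfac : Factorises (L ^ k) K) (hK0 : ∀ φ, K ∅ φ = 1) (hKd : ∀ Y, ContDiff ℝ r₀ (K Y))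
    (hKloc : ∀ Y, IsPolymer (L ^ k) Y → IsConn Y →
      IsGaugeLocal ((abkmNormParams L N Mord R p r₀ h θbar A (schedDelta δ₀ δ₁ N) 𝒞).gauge k Y) (K Y))
    {ℓ κ : ℝ} (hℓ : 0 ≤ ℓ) (hκ : 0 ≤ κ)
    (hdiff : ∀ X : Finset (Fin d → ZMod M), IsPolymer (L ^ k) X →
      ∀ (F : ((Fin d → ZMod M) → ℝ) → ℂ) (b : ℝ), 0 ≤ b → ContDiff ℝ r₀ F →
        IsGaugeLocal ((abkmNormParams L N Mord R p r₀ h θbar A (schedDelta δ₀ δ₁ N) 𝒞).gauge k X) F →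
        TayNormLE ((abkmNormParams L N Mord R p r₀ h θbar A (schedDelta δ₀ δ₁ N) 𝒞).gauge k X) r₀
          ((abkmWeightData L N Mord R θbar (schedDelta δ₀ δ₁ N) 𝒞).weight k X) F b →
          TayNormLE ((abkmNormParams L N Mord R p r₀ h θbar A (schedDelta δ₀ δ₁ N) 𝒞).gauge k X) r₀
            ((abkmWeightData L N Mord R θbar (schedDelta δ₀ δ₁ N) 𝒞).midWeight k X)
            (fluct 𝒞a F - fluct 𝒞b F) (b * ℓ * κ ^ numBlocks (L ^ k) X)) :
    TayNormLE ((abkmNormParams L N Mord R p r₀ h θbar A (schedDelta δ₀ δ₁ N) 𝒞).gauge (k + 1) U) r₀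
      ((abkmWeightData L N Mord R θbar (schedDelta δ₀ δ₁ N) 𝒞).weight (k + 1) U)
      (fun φ => ∑ X ∈ (polys (L ^ k) univ).filter (fun X => reblock (L ^ k) (L * L ^ k) X = U),
        ∑ X₁ ∈ polys (L ^ k) X,
        (bprod (L ^ k) (fun B => expNegH Ht B φ) (U \ X) * bprod (L ^ k) (fun B => expNegH (-Ht) B φ) (X \ U) *
            (bprod (L ^ k) (fun B => 1 - expNegH Ht B φ) X₁ * fluct 𝒞a (polyP2 (L ^ k) H K (X \ X₁)) φ) -
          bprod (L ^ k) (fun B => expNegH Ht' B φ) (U \ X) * bprod (L ^ k) (fun B => expNegH (-Ht') B φ) (X \ U) *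
            (bprod (L ^ k) (fun B => 1 - expNegH Ht' B φ) X₁ *
              fluct 𝒞b (polyP2 (L ^ k) H K (X \ X₁)) φ)))
      (∑ X ∈ (polys (L ^ k) univ).filter (fun X => reblock (L ^ k) (L * L ^ k) X = U),
        ∑ X₁ ∈ polys (L ^ k) X,
        (((∏ _B ∈ blocks (L ^ k) (U \ X), (Real.exp (1 / 4) +
              16 * Real.exp (3 / 8) * hamNorm (fieldWt h (L : ℝ) d k) ((L : ℝ) ^ k) (L ^ (d * k)) (Ht - Ht'))) -
            ∏ _B ∈ blocks (L ^ k) (U \ X), Real.exp (1 / 4)) *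
            (∏ _B ∈ blocks (L ^ k) (X \ U), Real.exp (1 / 4)) *
            ((∏ _B ∈ blocks (L ^ k) X₁, 8 * Real.exp (1 / 4) * τ) *
              ((∑ Y ∈ polys (L ^ k) (X \ X₁), (∏ _B ∈ blocks (L ^ k) ((X \ X₁) \ Y),
                8 * Real.exp (1 / 4) * hamNorm (fieldWt h (L : ℝ) d k) ((L : ℝ) ^ k) (L ^ (d * k)) H) *
                ∏ Z ∈ components Y, C *
                  (abkmNormParams L N Mord R p r₀ h θbar A (schedDelta δ₀ δ₁ N) 𝒞).aFactor k Z) *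
                A𝒫a ^ numBlocks (L ^ k) (X \ X₁))) +
          (∏ _B ∈ blocks (L ^ k) (U \ X), Real.exp (1 / 4)) *
            ((∏ _B ∈ blocks (L ^ k) (X \ U), (Real.exp (1 / 4) +
              16 * Real.exp (3 / 8) * hamNorm (fieldWt h (L : ℝ) d k) ((L : ℝ) ^ k) (L ^ (d * k)) (Ht - Ht'))) -
              ∏ _B ∈ blocks (L ^ k) (X \ U), Real.exp (1 / 4)) *
            ((∏ _B ∈ blocks (L ^ k) X₁, 8 * Real.exp (1 / 4) * τ) *
              ((∑ Y ∈ polys (L ^ k) (X \ X₁), (∏ _B ∈ blocks (L ^ k) ((X \ X₁) \ Y),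
                8 * Real.exp (1 / 4) * hamNorm (fieldWt h (L : ℝ) d k) ((L : ℝ) ^ k) (L ^ (d * k)) H) *
                ∏ Z ∈ components Y, C *
                  (abkmNormParams L N Mord R p r₀ h θbar A (schedDelta δ₀ δ₁ N) 𝒞).aFactor k Z) *
                A𝒫a ^ numBlocks (L ^ k) (X \ X₁))) +
          (∏ _B ∈ blocks (L ^ k) (U \ X), Real.exp (1 / 4)) * (∏ _B ∈ blocks (L ^ k) (X \ U), Real.exp (1 / 4)) *
            (((∏ _B ∈ blocks (L ^ k) X₁, (8 * Real.exp (1 / 4) * τ +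
                16 * Real.exp (3 / 8) * hamNorm (fieldWt h (L : ℝ) d k) ((L : ℝ) ^ k) (L ^ (d * k)) (Ht - Ht'))) -
              ∏ _B ∈ blocks (L ^ k) X₁, 8 * Real.exp (1 / 4) * τ) *
              ((∑ Y ∈ polys (L ^ k) (X \ X₁), (∏ _B ∈ blocks (L ^ k) ((X \ X₁) \ Y),
                8 * Real.exp (1 / 4) * hamNorm (fieldWt h (L : ℝ) d k) ((L : ℝ) ^ k) (L ^ (d * k)) H) *
                ∏ Z ∈ components Y, C *
                  (abkmNormParams L N Mord R p r₀ h θbar A (schedDelta δ₀ δ₁ N) 𝒞).aFactor k Z) *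
                A𝒫a ^ numBlocks (L ^ k) (X \ X₁))) +
          (∏ _B ∈ blocks (L ^ k) (U \ X), Real.exp (1 / 4)) * (∏ _B ∈ blocks (L ^ k) (X \ U), Real.exp (1 / 4)) *
            ((∏ _B ∈ blocks (L ^ k) X₁, 8 * Real.exp (1 / 4) * τ) *
              (if X \ X₁ = ∅ then 0 else
                (∑ Y ∈ polys (L ^ k) (X \ X₁), (∏ _B ∈ blocks (L ^ k) ((X \ X₁) \ Y),
                  8 * Real.exp (1 / 4) * hamNorm (fieldWt h (L : ℝ) d k) ((L : ℝ) ^ k) (L ^ (d * k)) H) *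
                  ∏ Z ∈ components Y, C *
                    (abkmNormParams L N Mord R p r₀ h θbar A (schedDelta δ₀ δ₁ N) 𝒞).aFactor k Z) *
                  ℓ * κ ^ numBlocks (L ^ k) (X \ X₁))))) := by
  set P := abkmNormParams L N Mord R p r₀ h θbar A (schedDelta δ₀ δ₁ N) 𝒞 with hP
  set W := abkmWeightData L N Mord R θbar (schedDelta δ₀ δ₁ N) 𝒞 with hW
  set s := L ^ k with hs
  set r : ℕ := (2 ^ d - 1) * s with hr
  set 𝓧 := (polys s univ).filter (fun X => reblock s (L * s) X = U) with h𝓧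
  set 𝓑 := (blocks s (thicken r U)).filter (fun B => B ⊆ thicken r U) with h𝓑
  -- sizes
  have h8 : 8 ≤ 2 ^ (d + 3) := by
    calc 8 = 2 ^ 3 := by norm_num
      _ ≤ 2 ^ (d + 3) := Nat.pow_le_pow_right (by norm_num) (by omega)
  have h2dle : 2 ^ d ≤ 2 ^ (d + 3) := Nat.pow_le_pow_right (by norm_num) (by omega)
  have hL4 : 4 ≤ L := by omega
  have hLR : 2 ^ d + R ≤ L := by omega
  have hd2 : 2 ≤ d := by omega
  have hL0 : (0 : ℝ) < L := by exact_mod_cast hLodd.pos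
  have hkN' : k ≤ N := by omega
  have hk1 : k + 1 ≤ N + 1 := by omega
  obtain ⟨t, ht⟩ : ∃ t, N = k + t := ⟨N - k, by omega⟩
  have hMt : M = s * L ^ t := by rw [hs, ← pow_add, ← ht]; exact hM
  have htodd : Odd (L ^ t) := hLodd.pow
  have hsodd : Odd s := hLodd.pow
  have hMo : Odd M := by rw [hM]; exact hLodd.pow
  have hU' : IsPolymer (L * s) U := by
    rw [show L * s = L ^ (k + 1) by rw [hs, pow_succ']]; exact hU
  have hUk : IsPolymer s U := hU'.of_mul hsodd hLodd
  -- gauges and radii of the two scales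
  have h𝔥k : 0 < P.𝔥 k := fieldWt_pos hh hL0 d k
  have h𝔥 : 0 < P.𝔥 (k + 1) := fieldWt_pos hh hL0 d (k + 1)
  have hsucc : P.𝔥 (k + 1) = scaleRatio d L * P.𝔥 k := fieldWt_succ_nat hLodd.pos d k
  have h𝔥le : P.𝔥 (k + 1) ≤ P.𝔥 k := by
    rw [hsucc]; exact mul_le_of_le_one_left h𝔥k.le (scaleRatio_le_one hd hL4)
  have hRk : 0 < P.R k := by show (0 : ℝ) < (L : ℝ) ^ k; positivity
  have hRle : P.R k ≤ P.R (k + 1) := by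
    show (L : ℝ) ^ k ≤ (L : ℝ) ^ (k + 1)
    exact pow_le_pow_right₀ (by exact_mod_cast hLodd.pos) (by omega)
  have hrad' : P.rad k + (2 ^ d - 1) * P.L ^ k ≤ P.rad (k + 1) := starRad_add_le_succ hLR k
  -- every `X ∈ 𝓧` lies in `U + [−r, r]^d`
  have h𝓧p : ∀ X ∈ 𝓧, IsPolymer s X := fun X hX => (mem_polys.1 (mem_filter.1 hX).1).2
  have h𝓧sub : ∀ X ∈ 𝓧, X ⊆ thicken r U := fun X hX => by
    obtain ⟨-, hXU⟩ := mem_filter.1 hX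
    rw [← hXU]
    exact TorusPolymer.subset_thicken_reblock hMt hsodd htodd hLodd X
  -- the gauge chain `T_k^{Y*} ≤ T_{k+1}^{U*}` for `Y ⊆ U + [−r,r]^d`
  have hgauge : ∀ Y ⊆ thicken r U, ∀ ξ, ‖P.gauge k Y ξ‖ ≤ ‖P.gauge (k + 1) U ξ‖ := by
    intro Y hY ξ
    have hsub : thicken (P.rad k) Y ⊆ thicken (P.rad (k + 1)) U :=
      (thicken_mono _ hY).trans ((thicken_thicken _ _ _).trans (thicken_mono_rad hrad' _))
    show ‖fieldGauge (P.𝔥 k) (P.R k) P.p (thicken (P.rad k) Y) ξ‖ ≤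
      ‖fieldGauge (P.𝔥 (k + 1)) (P.R (k + 1)) P.p (thicken (P.rad (k + 1)) U) ξ‖
    exact (norm_fieldGauge_mono_set _ _ _ hsub ξ).trans (norm_fieldGauge_mono_weights h𝔥 h𝔥le hRk hRle _ _ ξ)
  -- the block family
  have h𝓑₁ : ∀ X ∈ 𝓧, blocks s (U \ X) ⊆ 𝓑 := fun X hX =>
    blocks_subset_filter_of_subset (hUk.sdiff (h𝓧p X hX)) (sdiff_subset.trans (subset_thicken r U))
  have h𝓑₂ : ∀ X ∈ 𝓧, blocks s (X \ U) ⊆ 𝓑 := fun X hX =>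
    blocks_subset_filter_of_subset ((h𝓧p X hX).sdiff hUk) (sdiff_subset.trans (h𝓧sub X hX))
  have h𝓑₃ : ∀ X ∈ 𝓧, blocks s X ⊆ 𝓑 := fun X hX =>
    blocks_subset_filter_of_subset (h𝓧p X hX) (h𝓧sub X hX)
  have hle : ∀ B ∈ 𝓑, ∀ ξ, ‖P.gauge k B ξ‖ ≤ ‖P.gauge (k + 1) U ξ‖ := fun B hB =>
    hgauge B (mem_filter.1 hB).2
  -- the strong family
  set G : ℕ → Finset (Fin d → ZMod M) → Matrix (Fin d → ZMod M) (Fin d → ZMod M) ℝ :=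
    fun j Y => strongCoef h N j • derivForm (L : ℝ) j (diffIndex d Mord)
      (boxDensity (boxRad R L j) (boxWt (L : ℝ) d j) Y) with hG
  have hW0 : ∀ B φ, 0 ≤ expWeight (G k B) φ := fun B φ => by unfold expWeight; exact (Real.exp_pos _).le
  -- block constants
  have hcard : ∀ x, (blockOf s x).card = L ^ (d * k) := fun x => by
    rw [TorusPolymer.card_blockOf hMt hsodd htodd x, hs, ← pow_mul, mul_comm]
  have hnn : ∀ H₀ : RelevantHamiltonian ℂ d,
      0 ≤ hamNorm (fieldWt h (L : ℝ) d k) ((L : ℝ) ^ k) (L ^ (d * k)) H₀ := fun H₀ =>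
    hamNorm_nonneg (fieldWt_pos hh hL0 d k).le (by positivity) _ H₀
  have hτ0 : 0 ≤ τ := (hnn Ht).trans hHt
  set Δ : ℝ := 16 * Real.exp (3 / 8) * hamNorm (fieldWt h (L : ℝ) d k) ((L : ℝ) ^ k) (L ^ (d * k)) (Ht - Ht')
    with hΔdef
  have hΔ0 : 0 ≤ Δ := by have := hnn (Ht - Ht'); rw [hΔdef]; positivity
  -- the block functionals on a block `B = B_x`
  have hblk : ∀ B ∈ 𝓑, ∃ x, B = blockOf s x := fun B hB => by
    obtain ⟨x, -, rfl⟩ := mem_blocks.1 (mem_filter.1 hB).1; exact ⟨x, rfl⟩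
  have hexp : ∀ (H₀ : RelevantHamiltonian ℂ d), hamNorm (fieldWt h (L : ℝ) d k) ((L : ℝ) ^ k) (L ^ (d * k)) H₀ ≤ 1 / 16 →
      ∀ B ∈ 𝓑, TayNormLE (P.gauge k B) r₀ (expWeight (G k B)) (expNegH H₀ B) (Real.exp (1 / 4)) := by
    intro H₀ hH₀ B hB
    obtain ⟨x, rfl⟩ := hblk B hB
    have h1 : hamNorm (fieldWt h (L : ℝ) d k) ((L : ℝ) ^ k) (blockOf s x).card H₀ ≤ 1 / 8 := by
      rw [hcard x]; linarith
    exact tayNormLE_expNegH_strong_abkm (R := R) (N := N) (Mord := Mord) hd2 hLodd hM hkN' hh hMord hp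
      (subset_thicken (P.rad k) (blockOf s x)) r₀ h1
  have hexpsub : ∀ (H₀ H₀' : RelevantHamiltonian ℂ d),
      hamNorm (fieldWt h (L : ℝ) d k) ((L : ℝ) ^ k) (L ^ (d * k)) H₀ ≤ 1 / 16 →
      hamNorm (fieldWt h (L : ℝ) d k) ((L : ℝ) ^ k) (L ^ (d * k)) H₀' ≤ 1 / 16 →
      ∀ B ∈ 𝓑, TayNormLE (P.gauge k B) r₀ (expWeight (G k B))
        (fun ψ => expNegH H₀ B ψ - expNegH H₀' B ψ)
        (16 * Real.exp (3 / 8) * hamNorm (fieldWt h (L : ℝ) d k) ((L : ℝ) ^ k) (L ^ (d * k)) (H₀ - H₀')) := by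
    intro H₀ H₀' hH₀ hH₀' B hB
    obtain ⟨x, rfl⟩ := hblk B hB
    have h1 : hamNorm (fieldWt h (L : ℝ) d k) ((L : ℝ) ^ k) (blockOf s x).card H₀ ≤ 1 / 16 := by
      rw [hcard x]; exact hH₀
    have h2 : hamNorm (fieldWt h (L : ℝ) d k) ((L : ℝ) ^ k) (blockOf s x).card H₀' ≤ 1 / 16 := by
      rw [hcard x]; exact hH₀'
    have := tayNormLE_expNegH_sub_strong_abkm (R := R) (N := N) (Mord := Mord) hd2 hLodd hM hkN' hh hMord hp
      (subset_thicken (P.rad k) (blockOf s x)) r₀ h1 h2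
    rw [hcard x] at this
    exact this
  have hHt16 : hamNorm (fieldWt h (L : ℝ) d k) ((L : ℝ) ^ k) (L ^ (d * k)) Ht ≤ 1 / 16 := hHt.trans hτ
  have hHt16' : hamNorm (fieldWt h (L : ℝ) d k) ((L : ℝ) ^ k) (L ^ (d * k)) Ht' ≤ 1 / 16 := hHt'.trans hτ
  have hnHt16 : hamNorm (fieldWt h (L : ℝ) d k) ((L : ℝ) ^ k) (L ^ (d * k)) (-Ht) ≤ 1 / 16 := by
    rw [hamNorm_neg]; exact hHt16
  have hnHt16' : hamNorm (fieldWt h (L : ℝ) d k) ((L : ℝ) ^ k) (L ^ (d * k)) (-Ht') ≤ 1 / 16 := by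
    rw [hamNorm_neg]; exact hHt16'
  have hnegsub : hamNorm (fieldWt h (L : ℝ) d k) ((L : ℝ) ^ k) (L ^ (d * k)) (-Ht - -Ht') =
      hamNorm (fieldWt h (L : ℝ) d k) ((L : ℝ) ^ k) (L ^ (d * k)) (Ht - Ht') := by
    rw [show -Ht - -Ht' = -(Ht - Ht') by abel, hamNorm_neg]
  have hswapsub : hamNorm (fieldWt h (L : ℝ) d k) ((L : ℝ) ^ k) (L ^ (d * k)) (Ht' - Ht) =
      hamNorm (fieldWt h (L : ℝ) d k) ((L : ℝ) ^ k) (L ^ (d * k)) (Ht - Ht') := by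
    rw [show Ht' - Ht = -(Ht - Ht') by abel, hamNorm_neg]
  -- slot 1: `e^{−H̃}`
  have hF₁ : ∀ B ∈ 𝓑, TayNormLE (P.gauge k B) r₀ (expWeight (G k B)) (fun φ => expNegH Ht B φ) (Real.exp (1 / 4)) :=
    hexp Ht hHt16
  have hF₁' : ∀ B ∈ 𝓑, TayNormLE (P.gauge k B) r₀ (expWeight (G k B)) (fun φ => expNegH Ht' B φ) (Real.exp (1 / 4)) :=
    hexp Ht' hHt16'
  have hΔ₁ : ∀ B ∈ 𝓑, TayNormLE (P.gauge k B) r₀ (expWeight (G k B))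
      (fun φ => expNegH Ht B φ - expNegH Ht' B φ) Δ := hexpsub Ht Ht' hHt16 hHt16'
  -- slot 2: `e^{+H̃} = e^{−(−H̃)}`
  have hF₂ : ∀ B ∈ 𝓑, TayNormLE (P.gauge k B) r₀ (expWeight (G k B)) (fun φ => expNegH (-Ht) B φ) (Real.exp (1 / 4)) :=
    hexp (-Ht) hnHt16
  have hF₂' : ∀ B ∈ 𝓑, TayNormLE (P.gauge k B) r₀ (expWeight (G k B)) (fun φ => expNegH (-Ht') B φ) (Real.exp (1 / 4)) :=
    hexp (-Ht') hnHt16'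
  have hΔ₂ : ∀ B ∈ 𝓑, TayNormLE (P.gauge k B) r₀ (expWeight (G k B))
      (fun φ => expNegH (-Ht) B φ - expNegH (-Ht') B φ) Δ := by
    intro B hB
    have := hexpsub (-Ht) (-Ht') hnHt16 hnHt16' B hB
    rw [hnegsub] at this
    exact this
  -- slot 3: `1 − e^{−H̃}`
  have hF₃gen : ∀ (H₀ : RelevantHamiltonian ℂ d), hamNorm (fieldWt h (L : ℝ) d k) ((L : ℝ) ^ k) (L ^ (d * k)) H₀ ≤ τ →
      ∀ B ∈ 𝓑, TayNormLE (P.gauge k B) r₀ (expWeight (G k B)) (fun φ => 1 - expNegH H₀ B φ)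
        (8 * Real.exp (1 / 4) * τ) := by
    intro H₀ hH₀ B hB
    obtain ⟨x, rfl⟩ := hblk B hB
    have h1 : hamNorm (fieldWt h (L : ℝ) d k) ((L : ℝ) ^ k) (blockOf s x).card H₀ ≤ 1 / 8 := by
      rw [hcard x]; linarith
    have h0 := tayNormLE_expNegH_sub_one_strong_abkm (R := R) (N := N) (Mord := Mord) hd2 hLodd hM hkN' hh
      hMord hp (subset_thicken (P.rad k) (blockOf s x)) r₀ h1
    rw [hcard x] at h0
    have hcd : ContDiff ℝ r₀ (fun ψ : (Fin d → ZMod M) → ℝ => expNegH H₀ (blockOf s x) ψ - 1) :=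
      ((contDiff_eval H₀ (blockOf s x) (n := r₀)).neg.cexp).sub contDiff_const
    have h2 := h0.smul hcd (-1)
    have hfun : ((-1 : ℝ) • fun ψ : (Fin d → ZMod M) → ℝ => expNegH H₀ (blockOf s x) ψ - 1) =
        fun ψ => 1 - expNegH H₀ (blockOf s x) ψ := by
      funext ψ; simp [neg_sub]
    rw [hfun, abs_neg, abs_one, one_mul] at h2
    refine h2.mono ?_ (hW0 _)
    exact mul_le_mul_of_nonneg_left hH₀ (by positivity)
  have hF₃ := hF₃gen Ht hHt
  have hF₃' := hF₃gen Ht' hHt'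
  have hΔ₃ : ∀ B ∈ 𝓑, TayNormLE (P.gauge k B) r₀ (expWeight (G k B))
      (fun φ => (1 - expNegH Ht B φ) - (1 - expNegH Ht' B φ)) Δ := by
    intro B hB
    have := hexpsub Ht' Ht hHt16' hHt16 B hB
    rw [hswapsub] at this
    have hfun : (fun φ : (Fin d → ZMod M) → ℝ => (1 - expNegH Ht B φ) - (1 - expNegH Ht' B φ)) =
        fun φ => expNegH Ht' B φ - expNegH Ht B φ := by
      funext φ; ring
    rw [hfun]
    exact this
  -- smoothness and locality of the block functionals
  have hcdE : ∀ (H₀ : RelevantHamiltonian ℂ d), ∀ B ∈ 𝓑, ContDiff ℝ r₀ (fun φ : (Fin d → ZMod M) → ℝ => expNegH H₀ B φ) :=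
    fun H₀ B _ => (contDiff_eval H₀ B (n := r₀)).neg.cexp
  have hcd3 : ∀ (H₀ : RelevantHamiltonian ℂ d), ∀ B ∈ 𝓑,
      ContDiff ℝ r₀ (fun φ : (Fin d → ZMod M) → ℝ => 1 - expNegH H₀ B φ) :=
    fun H₀ B _ => contDiff_const.sub (contDiff_eval H₀ B (n := r₀)).neg.cexp
  have hlocE : ∀ (H₀ : RelevantHamiltonian ℂ d), ∀ B ∈ 𝓑,
      IsGaugeLocal (P.gauge k B) (fun φ : (Fin d → ZMod M) → ℝ => expNegH H₀ B φ) :=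
    fun H₀ B _ => isGaugeLocal_cexp_neg_eval h𝔥k.ne' hRk.ne' hp (subset_thicken _ _) H₀
  have hloc3 : ∀ (H₀ : RelevantHamiltonian ℂ d), ∀ B ∈ 𝓑,
      IsGaugeLocal (P.gauge k B) (fun φ : (Fin d → ZMod M) → ℝ => 1 - expNegH H₀ B φ) :=
    fun H₀ B hB => IsGaugeLocal.op₁ _ (fun z : ℂ => 1 - z) (hlocE H₀ B hB)
  have ha : ∀ B ∈ 𝓑, (0 : ℝ) ≤ Real.exp (1 / 4) := fun _ _ => (Real.exp_pos _).le
  have ha₃ : ∀ B ∈ 𝓑, (0 : ℝ) ≤ 8 * Real.exp (1 / 4) * τ := fun _ _ => by positivity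
  have hδ : ∀ B ∈ 𝓑, (0 : ℝ) ≤ Δ := fun _ _ => hΔ0
  -- the inner factor `R P₂(X ∖ X₁)`
  have hH8 : hamNorm (fieldWt h (L : ℝ) d k) ((L : ℝ) ^ k) (L ^ (d * k)) H ≤ 1 / 8 := by linarith
  have haF : ∀ Z, 0 ≤ P.aFactor k Z := fun Z => (WeakNormLE.aFactor_pos hA k Z).le
  have hX₂p : ∀ X ∈ 𝓧, ∀ X₁ ∈ polys s X, IsPolymer s (X \ X₁) := fun X hX X₁ hX₁ =>
    (h𝓧p X hX).sdiff (mem_polys.1 hX₁).2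
  have hG' : ∀ X ∈ 𝓧, ∀ X₁ ∈ polys s X, TayNormLE (P.gauge k (X \ X₁)) r₀ (W.midWeight k (X \ X₁))
      (fluct 𝒞a (polyP2 s H K (X \ X₁)))
      ((∑ Y ∈ polys s (X \ X₁), (∏ _B ∈ blocks s ((X \ X₁) \ Y),
        8 * Real.exp (1 / 4) * hamNorm (fieldWt h (L : ℝ) d k) ((L : ℝ) ^ k) (L ^ (d * k)) H) *
        ∏ Z ∈ components Y, C * P.aFactor k Z) * A𝒫a ^ numBlocks s (X \ X₁)) := fun X hX X₁ hX₁ =>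
    tayNormLE_fluct_polyP2_abkm_of_stepKernelBounds hd2 hLodd hM hkN hSa hp hMord hB hδ₀ hδ₁ hh hh0 hA (hX₂p X hX X₁ hX₁)
      hH8 hC hK hKfac hK0 hKd hKloc
  have hΔG : ∀ X ∈ 𝓧, ∀ X₁ ∈ polys s X, TayNormLE (P.gauge k (X \ X₁)) r₀ (W.midWeight k (X \ X₁))
      (fun φ => fluct 𝒞a (polyP2 s H K (X \ X₁)) φ - fluct 𝒞b (polyP2 s H K (X \ X₁)) φ)
      (if X \ X₁ = ∅ then 0 else
        (∑ Y ∈ polys s (X \ X₁), (∏ _B ∈ blocks s ((X \ X₁) \ Y),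
          8 * Real.exp (1 / 4) * hamNorm (fieldWt h (L : ℝ) d k) ((L : ℝ) ^ k) (L ^ (d * k)) H) *
          ∏ Z ∈ components Y, C * P.aFactor k Z) * ℓ * κ ^ numBlocks s (X \ X₁)) := by
    intro X hX X₁ hX₁
    by_cases h0 : X \ X₁ = ∅
    · rw [if_pos h0, h0, polyP2_empty s H hK0, fluct_const, fluct_const]
      intro φ
      have : (fun φ : (Fin d → ZMod M) → ℝ => ((fun _ => (1 : ℂ)) : ((Fin d → ZMod M) → ℝ) → ℂ) φ -
          ((fun _ => (1 : ℂ)) : ((Fin d → ZMod M) → ℝ) → ℂ) φ) = fun _ => (0 : ℂ) := by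
        funext ψ; simp
      rw [this, tayNorm_const, norm_zero, zero_mul]
    · rw [if_neg h0]
      have hP2 := tayNormLE_polyP2_abkm hd2 hLodd hM hkN hp hMord hB hδ₀ hδ₁ hh hh0 hA (hX₂p X hX X₁ hX₁) hH8 hC hK
        hKfac hK0 hKd hKloc
      have hb0 : (0 : ℝ) ≤ ∑ Y ∈ polys s (X \ X₁), (∏ _B ∈ blocks s ((X \ X₁) \ Y),
          8 * Real.exp (1 / 4) * hamNorm (fieldWt h (L : ℝ) d k) ((L : ℝ) ^ k) (L ^ (d * k)) H) *
          ∏ Z ∈ components Y, C * P.aFactor k Z := by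
        have := hnn H
        exact sum_nonneg fun Y _ => mul_nonneg (prod_nonneg fun _ _ => by positivity)
          (prod_nonneg fun Z _ => mul_nonneg hC (haF Z))
      exact hdiff (X \ X₁) (hX₂p X hX X₁ hX₁) _ _ hb0 (contDiff_polyP2 _ H hKd _)
        (isGaugeLocal_polyP2_abkm hLodd hM (by omega) hh hp H hKfac hK0 hKloc (hX₂p X hX X₁ hX₁)) hP2
  have hGd : ∀ X ∈ 𝓧, ∀ X₁ ∈ polys s X, ContDiff ℝ r₀ (fluct 𝒞a (polyP2 s H K (X \ X₁))) :=
    fun X hX X₁ hX₁ => contDiff_fluct_polyP2_abkm_of_stepKernelBounds hd2 hLodd hM hkN hSa hp hMord hB hδ₀ hδ₁ hh hh0 hA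
      (hX₂p X hX X₁ hX₁) hH8 hC hK hKfac hK0 hKd hKloc
  have hG'd : ∀ X ∈ 𝓧, ∀ X₁ ∈ polys s X, ContDiff ℝ r₀ (fluct 𝒞b (polyP2 s H K (X \ X₁))) :=
    fun X hX X₁ hX₁ => contDiff_fluct_polyP2_abkm_of_stepKernelBounds hd2 hLodd hM hkN hSb hp hMord hB hδ₀ hδ₁ hh hh0 hA
      (hX₂p X hX X₁ hX₁) hH8 hC hK hKfac hK0 hKd hKloc
  have hGloc : ∀ X ∈ 𝓧, ∀ X₁ ∈ polys s X,
      IsGaugeLocal (P.gauge k (X \ X₁)) (fluct 𝒞a (polyP2 s H K (X \ X₁))) := fun X hX X₁ hX₁ =>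
    isGaugeLocal_fluct_polyP2_abkm hLodd hM hkN' hh hp H 𝒞a hKfac hK0 hKloc (hX₂p X hX X₁ hX₁)
  have hG'loc : ∀ X ∈ 𝓧, ∀ X₁ ∈ polys s X,
      IsGaugeLocal (P.gauge k (X \ X₁)) (fluct 𝒞b (polyP2 s H K (X \ X₁))) := fun X hX X₁ hX₁ =>
    isGaugeLocal_fluct_polyP2_abkm hLodd hM hkN' hh hp H 𝒞b hKfac hK0 hKloc (hX₂p X hX X₁ hX₁)
  have hg : ∀ X ∈ 𝓧, ∀ X₁ ∈ polys s X, (0 : ℝ) ≤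
      (∑ Y ∈ polys s (X \ X₁), (∏ _B ∈ blocks s ((X \ X₁) \ Y),
        8 * Real.exp (1 / 4) * hamNorm (fieldWt h (L : ℝ) d k) ((L : ℝ) ^ k) (L ^ (d * k)) H) *
        ∏ Z ∈ components Y, C * P.aFactor k Z) * A𝒫a ^ numBlocks s (X \ X₁) := by
    intro X _ X₁ _
    have := hnn H
    exact mul_nonneg (sum_nonneg fun Y _ => mul_nonneg (prod_nonneg fun _ _ => by positivity)
      (prod_nonneg fun Z _ => mul_nonneg hC (haF Z))) (pow_nonneg hA𝒫 _)
  have hρ : ∀ X ∈ 𝓧, ∀ X₁ ∈ polys s X, (0 : ℝ) ≤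
      (if X \ X₁ = ∅ then 0 else
        (∑ Y ∈ polys s (X \ X₁), (∏ _B ∈ blocks s ((X \ X₁) \ Y),
          8 * Real.exp (1 / 4) * hamNorm (fieldWt h (L : ℝ) d k) ((L : ℝ) ^ k) (L ^ (d * k)) H) *
          ∏ Z ∈ components Y, C * P.aFactor k Z) * ℓ * κ ^ numBlocks s (X \ X₁)) := by
    intro X _ X₁ _
    split_ifs
    · exact le_rfl
    · have := hnn H
      exact mul_nonneg (mul_nonneg (sum_nonneg fun Y _ => mul_nonneg (prod_nonneg fun _ _ => by positivity)
        (prod_nonneg fun Z _ => mul_nonneg hC (haF Z))) hℓ) (pow_nonneg hκ _)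
  have hlep : ∀ X ∈ 𝓧, ∀ X₁ ∈ polys s X, ∀ ξ, ‖P.gauge k (X \ X₁) ξ‖ ≤ ‖P.gauge (k + 1) U ξ‖ :=
    fun X hX X₁ _ => hgauge (X \ X₁) (sdiff_subset.trans (h𝓧sub X hX))
  -- the weight inequality
  have hGs : W.StrongDominated G fun _ X Y => Disjoint X Y :=
    hB.strong (diffIndex d Mord) (fun α hα => hα) (strongCoef h N) (strongCoef_le hδ₀ hδ₁ hh hh0)
  have hrstar : r ≤ starRad R L d (k + 1) := by
    have : P.rad (k + 1) = starRad R L d (k + 1) := rfl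
    have h' : (2 ^ d - 1) * P.L ^ k ≤ P.rad (k + 1) := le_trans (Nat.le_add_left _ _) hrad'
    rw [hr, hs]; exact h'
  have hrplus : r ≤ plusRad R L (k + 1) := by
    show (2 ^ d - 1) * L ^ k ≤ L ^ (k + 1)
    rw [pow_succ']
    exact Nat.mul_le_mul_right _ (by omega)
  have hw : ∀ X ∈ 𝓧, ∀ X₁ ∈ polys s X, ∀ φ, (∏ B ∈ blocks s (U \ X), expWeight (G k B) φ) *
      (∏ B ∈ blocks s (X \ U), expWeight (G k B) φ) *
      ((∏ B ∈ blocks s X₁, expWeight (G k B) φ) * W.midWeight k (X \ X₁) φ) ≤ W.weight (k + 1) U φ := by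
    intro X hX X₁ hX₁ φ
    have hXp := h𝓧p X hX
    obtain ⟨hX₁X, hX₁p⟩ := mem_polys.1 hX₁
    have hZp : IsPolymer s (U \ X ∪ X \ U) := (hUk.sdiff hXp).union (hXp.sdiff hUk)
    have hdisj : Disjoint (blocks s (U \ X)) (blocks s (X \ U)) :=
      (hUk.sdiff hXp).disjoint_blocks (hXp.sdiff hUk) (Finset.sdiff_disjoint.mono_right sdiff_subset)
    have hprod : (∏ B ∈ blocks s (U \ X), expWeight (G k B) φ) * (∏ B ∈ blocks s (X \ U), expWeight (G k B) φ) =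
        ∏ B ∈ blocks s (U \ X ∪ X \ U), expWeight (G k B) φ := by
      rw [TorusPolymer.blocks_union, prod_union hdisj]
    have hZU : U \ X ∪ X \ U ⊆ thicken (plusRad R L (k + 1)) U :=
      union_subset (sdiff_subset.trans (subset_thicken _ U))
        (sdiff_subset.trans ((h𝓧sub X hX).trans (thicken_mono_rad hrplus U)))
    have hX₁U : X₁ ⊆ thicken (plusRad R L (k + 1)) U :=
      hX₁X.trans ((h𝓧sub X hX).trans (thicken_mono_rad hrplus U))
    have hX₂U : X \ X₁ ⊆ thicken (starRad R L d (k + 1)) U :=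
      sdiff_subset.trans ((h𝓧sub X hX).trans (thicken_mono_rad hrstar U))
    have hmain := prod_strongWeight_sq_mul_midWeight_le_abkm hB hLodd hL hR2 hM hkN hδ₀ hδ₁ hh hh0 hU hX₂U hZp hZU
      hX₁p hX₁U φ
    calc (∏ B ∈ blocks s (U \ X), expWeight (G k B) φ) * (∏ B ∈ blocks s (X \ U), expWeight (G k B) φ) *
          ((∏ B ∈ blocks s X₁, expWeight (G k B) φ) * W.midWeight k (X \ X₁) φ)
        = (∏ B ∈ blocks s (U \ X ∪ X \ U), expWeight (G k B) φ) *
            (∏ B ∈ blocks s X₁, expWeight (G k B) φ) * W.midWeight k (X \ X₁) φ := by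
          rw [← hprod]; ring
      _ ≤ W.weight (k + 1) U φ := hmain
  -- assemble (all implicit data given explicitly, so that no metavariable sits under the binders)
  have key := tayNormLE_sum_reblockTerm_sub s (P.gauge (k + 1) U) (fun B => P.gauge k B) (fun Y => P.gauge k Y)
    (r₀ := r₀) (W := fun B => expWeight (G k B)) (wm := fun Y => W.midWeight k Y) (w := W.weight (k + 1) U)
    (F₁ := fun B φ => expNegH Ht B φ) (F₂ := fun B φ => expNegH (-Ht) B φ) (F₃ := fun B φ => 1 - expNegH Ht B φ)
    (F₁' := fun B φ => expNegH Ht' B φ) (F₂' := fun B φ => expNegH (-Ht') B φ)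
    (F₃' := fun B φ => 1 - expNegH Ht' B φ)
    (G := fun Y => fluct 𝒞a (polyP2 s H K Y)) (G' := fun Y => fluct 𝒞b (polyP2 s H K Y))
    (a₁ := fun _ => Real.exp (1 / 4)) (a₂ := fun _ => Real.exp (1 / 4)) (a₃ := fun _ => 8 * Real.exp (1 / 4) * τ)
    (δ₁ := fun _ => Δ) (δ₂ := fun _ => Δ) (δ₃ := fun _ => Δ)
    (g := fun X₂ => (∑ Y ∈ polys s X₂, (∏ _B ∈ blocks s (X₂ \ Y),
        8 * Real.exp (1 / 4) * hamNorm (fieldWt h (L : ℝ) d k) ((L : ℝ) ^ k) (L ^ (d * k)) H) *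
        ∏ Z ∈ components Y, C * P.aFactor k Z) * A𝒫a ^ numBlocks s X₂)
    (ρ := fun X₂ => if X₂ = ∅ then 0 else
      (∑ Y ∈ polys s X₂, (∏ _B ∈ blocks s (X₂ \ Y),
        8 * Real.exp (1 / 4) * hamNorm (fieldWt h (L : ℝ) d k) ((L : ℝ) ^ k) (L ^ (d * k)) H) *
        ∏ Z ∈ components Y, C * P.aFactor k Z) * ℓ * κ ^ numBlocks s X₂)
    𝓧 𝓑 hUk h𝓧p h𝓑₁ h𝓑₂ h𝓑₃ hle
    hF₁ hF₁' hΔ₁ (hcdE Ht) (hcdE Ht') (hlocE Ht) (hlocE Ht') ha hδ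
    hF₂ hF₂' hΔ₂ (hcdE (-Ht)) (hcdE (-Ht')) (hlocE (-Ht)) (hlocE (-Ht')) ha hδ
    hF₃ hF₃' hΔ₃ (hcd3 Ht) (hcd3 Ht') (hloc3 Ht) (hloc3 Ht') ha₃ hδ
    hG' hΔG hGd hG'd hGloc hG'loc hg hρ hlep hw
  exact key

end Literature.MathematicalPhysics.StatisticalMechanics.GradientRG

end
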